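import Literature.MathematicalPhysics.QuantumFieldTheory.Balaban1983to89.B9Ineq349SiteSchemasR

/-!
# `Balaban1983to89.B9Ineq349SiteFacesAtLettersR` — T. Bałaban, *Propagators for lattice gauge theories in a background field*, Commun. Math. Phys. **99**
# (1985) 389–434 [Balaban1985BackgroundPropagators], (3.49) p. 399 ⇐ Thm 3.1 (3.42) p. 397 + Thm 3.2 (3.48) p. 398: ROW 25's KNIT FACE
# `s349_site_of_t37_display348_of` RE-PRESSED ONCE OVER THE CLASS-PARAMETRIC CARRIER `bg9YR 𝔸 G R₁ R₂` — the `s349` binder of the R-GENERIC N06 certificate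
# (`B9PinCarriersKLevelV1R.b9LeafX_carriersYR`) in ONE call (CASCADE-R STEP 2, n06-i share)

[4] = T. Bałaban, *Propagators and renormalization transformations for lattice gauge theories. II*, Commun. Math. Phys. **96** (1984) 223–250 [`Balaban1984PropagatorsII`].

statement-level skeleton of published theorems with citation tags; proofs where landed; nothing here is a claim about the Yang–Mills mass gap

THE PRINT.  [B9] p. 399: *«Let us consider the operator P = I − R. We have ∇_U P_U = −∇_U R_U, hence using again Lemma 2.1 of [4] we get
|(∇_U^β P_U)(U, x, x′)| ≦ O(1)(L^{j₀}η)^{−d−1−|β|} exp(−δ(L^{j₀}η)⁻¹|x − x′|) (3.49)»*; p. 397 Thm 3.1 (3.42); p. 398 Thm 3.2 (3.48); p. 410 *«Theorem 3.7 implies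
… (3.42)–(3.47)»*; p. 413 *«This theorem [3.9] implies Theorem 3.2»*; p. 396 (3.35) *«U with values in G»*; p. 394 (3.25).

WHY THIS FILE (dag-n06-i gen 21).  dag-n06-d g12's STEP-3 FACE CENSUS (2026-08-28) lists row 25's knit face
`B9Ineq349SiteFacesAtLetters.s349_site_of_t37_display348_of` [n06-i] as «`bg9Y`-PINNED ✗ — R-twin = object re-typing + `MemOfFam`»; node00-def-Y g23 RULING-2
(α1): the R-generic certificate is pressed ONCE at `carriersYR … R₁ R₂ ops`, whose row-25 binder reads `s349 : B9.Stmt349Printed (d + 1) c35Y geo9Y (bg9YR 𝔸 G R₁ R₂)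
(fun x => fineKernelR R₁ R₂ (ops x).P349)`.  This file assembles that binder from the re-pressed schema layers (`B9Ineq349SiteSchemasR`, and
`B9Ineq349SiteFromBlocksR.stmt349Printed_site_of_blockSchemas_R`) exactly as `B9Ineq349SiteFacesAtLetters` assembles the Y-face: ROW 18's Theorem-3.7 leaf `t37`
on the `PairM` E-letter at the four site pins (walk model `𝔬 : B9Thm37Whole.Ops (geo9Y x) (bg9YR … x) …`, reading `rd`, kernel family `K` over the carrier), ROWS
15–16's one display `h348` premised on the carrier's (3.35), the faithful block map and the radius-2 count — plus the ONE displayed class hypothesis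
`hGR : MemOfFam SU(N) R₁` (the `G`-valuedness read `hU.1.1` of the Y-face).

WHAT IS PROVED (sorry-free, 0 def; `𝔸 = M_N(ℂ)`, `G = SU(N)`).
* §1 ★ `thm31SiteSchemasR_of_t37_pairM_of (R₁ R₂) (hGR) θ M⋆ 𝔏 hparS hGp b hlev hβ1 hnbr 𝔬 rd H hp t37 hblkS hblkYS hGpS hDS` —
  `Thm31SiteSchemasR (M_N(ℂ)) SU(N) c35 𝔏 R₁ R₂` from ROW 18's leaf at the carrier, for any letters family with the standard `parS ∕ Gp`.
* §2 ★★★ `s349_site_of_t37_display348_of_R (R₁ R₂) (hGR) θ M⋆ 𝔏 hparS hGp b hlev hβ1 hnbr 𝔬 rd H hp t37 hblkS hblkYS hGpS hDS hc hB hδ ha₁ hM₁ h348 :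
  B9.Stmt349Printed (d+1) c35 geo9Y (bg9YR … R₁ R₂) (fun x => fineKernelR R₁ R₂ (p349SiteY … x (𝔏 x)))` — ROW 25 OF THE R-GENERIC CERTIFICATE IN ONE CALL
  (`= fineKernelR R₁ R₂ (ops x).P349` by `rfl` at every `opsYS349Nu…` instance over `𝔏`); at `(regY335, regY336)` with `hGR := memOfFam_regY335` it is
  `s349_site_of_t37_display348_of` read at the carrier (`bg9Y = bg9YR regY335 regY336`, `rfl`).

CONSUMER NOTE (dag-n06-d, the R-edition).  `s349 := s349_site_of_t37_display348_of_R R₁ R₂ hGR θ' M⋆ 𝔏⁺ (fun _ => rfl) (fun _ => rfl) (trBasis N) hlev hβ1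
(hnbr_two_of_le hM₀) 𝔬R rdR H hp t37' hblkS hblkYS hGpS hDS hc hB39.le (…) ha39 hM39 h348` with `𝔬R ∕ rdR ∕ t37'` ROW 18's objects and leaf over `bg9YR … R₁ R₂`
(n06-c's bg-generic `rows131819_definite_geo9Y_pairM_dir₂` at `bg := bg9YR …`) and `h348` premised on `(bg9YR … x).Reg335 c35 α₀ U`; the Y-closer supplies
`hGR := memOfFam_regY335`.

HONEST SCOPE.  Re-typing bookkeeping (CASCADE-R STEP 2) of a LANDED derivation; the (3.35) class is a PARAMETER and its one use is a named binder; Theorem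
3.7's leaf (ROW 18) and the (3.48)⁻¹ display (ROWS 15–16) remain those rows' hypotheses; nothing of [B9] or [4] is asserted; count-neutral; N06 NOT discharged;
one finite 𝕋^{d+1} programme at fixed ε — nothing continuum, nothing OS, nothing about the mass gap.  Cell `pub-ymgap` (HUMAN RULING D-0062), Track A node N06
[B9], seat `pub-ymgap-dag-n06-i` (gen 21), 2026-08-28; a NEW file (APPEND-ONLY companion of `B9Ineq349SiteFacesAtLetters`, untouched).
-/

noncomputable section

namespace Literature.MathematicalPhysics.QuantumFieldTheory.Balaban1983to89.B9Ineq349SiteFacesAtLettersR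

open B6GlobalChartV1 (blkV1)
open B6Ineq2142KLevelV1 (lvl β)
open B9Thm37Whole (Ops)
open B9Cor38Whole (WalkReading)
open B9Thm39WholeBlk (Conv348Blk)
open B9Thm39OneCubeReadingAtLettersY (oneCubeOps39YF)
open B9CoReadingCoordsS (XSK blkSK sIK GcoS DcoS)
open B9Ineq349SiteReading (p349SiteY)
open B9Ineq349SiteFromBlocksR (Thm31SiteSchemasR stmt349Printed_site_of_blockSchemas_R)
open B9Ineq349SiteSchemasR (thm31LeftSchemaR_of_t37_pairM thm31LeftSchemaSymmR_of_std thm31SiteSchemasR_of_leftSymm thm32BlkSchemaR_of_display348)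
open B9RWSumsDefinitePins (PinPrims)
open B9RWSumsDefinitePinsPair (PairPrims)
open B9RWSumsDefinitePinsPairM (MixedPrims E37YPairM)
open B7Prop2SpecialUnitary (specialUnitaryUnits specialUnitaryUnits_le_unitaryUnits)
open B9PinMembersKLevelV1 (MemberY geo9Y bg9Y)
open B9BackgroundsKLevelV1R (RegFamY bg9YR fineKernelR MemOfFam mem_of_reg335R)
open B9RWSumsReadsNbr (nbr)
open Node00
open scoped Matrix.Norms.L2Operator

variable {N : ℕ} {κ : Type} [Fintype κ] [DecidableEq κ]

/-! ## §1 ★ The R-certificate's `Thm31SiteSchemasR` from ROW 18's leaf, for any `𝔏` with the standard `parS ∕ Gp` -/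

/-- ★ **`Thm31SiteSchemasR (M_N(ℂ)) SU(N) c35 𝔏 R₁ R₂` FROM ROW 18's THEOREM-3.7 LEAF ON THE `PairM` E-LETTER AT THE CARRIER** — at the four site pins, the
faithful block map and the radius-2 count, for any letters family with the standard `parS ∕ Gp`, under the displayed `hGR : MemOfFam SU(N) R₁` — the R-twin of
`B9Ineq349SiteFacesAtLetters.thm31SiteSchemas_of_t37_pairM_of`.
[cite: Balaban1985BackgroundPropagators, Thm 3.1 (3.42)–(3.47) p.397–398 ⇐ Thm 3.7 p.410; (3.25) p.394, (3.35) p.396] -/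
theorem thm31SiteSchemasR_of_t37_pairM_of (θ : Stage3Params) (Mstar : ℕ)
    (R₁ R₂ : RegFamY θ.d₆ θ.ℓ₆ θ.hd' θ.hL' θ.b₀ θ.b₁ Mstar (Matrix (Fin N) (Fin N) ℂ)) (hGR : MemOfFam (specialUnitaryUnits (Fin N)) R₁)
    (𝔏 : LettersY N θ Mstar)
    (hparS : ∀ x : MemberY θ.d₆ θ.ℓ₆ θ.hd' θ.hL' θ.b₀ θ.b₁ Mstar, (𝔏 x).parS = parSymY x.toKIdx)
    (hGp : ∀ x : MemberY θ.d₆ θ.ℓ₆ θ.hd' θ.hL' θ.b₀ θ.b₁ Mstar, (𝔏 x).Gp = GpY x.toKIdx (parSymY x.toKIdx))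
    [∀ x : MemberY θ.d₆ θ.ℓ₆ θ.hd' θ.hL' θ.b₀ θ.b₁ Mstar, Fintype (geo9Y x).Site] [∀ x : MemberY θ.d₆ θ.ℓ₆ θ.hd' θ.hL' θ.b₀ θ.b₁ Mstar, DecidableEq (geo9Y x).Site]
    (b : Module.Basis κ ℝ (Matrix (Fin N) (Fin N) ℂ)) {c35 : ℝ}
    {bI : ∀ x : MemberY θ.d₆ θ.ℓ₆ θ.hd' θ.hL' θ.b₀ θ.b₁ Mstar, FBondY x.toKIdx → IBondY x.toKIdx}
    (hlev : ∀ (x : MemberY θ.d₆ θ.ℓ₆ θ.hd' θ.hL' θ.b₀ θ.b₁ Mstar) (f : FBondY x.toKIdx), lvl x.hN x.D x.hk (bI x f) = (blkV1 x.hN x.D f).1.1)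
    (hβ1 : ∀ (x : MemberY θ.d₆ θ.ℓ₆ θ.hd' θ.hL' θ.b₀ θ.b₁ Mstar) (f : FBondY x.toKIdx),
      (B6Geom246MultiLevelTorus.geomT x.D).dist (β x.hN x.D x.hk (bI x f)) (blkV1 x.hN x.D f) ≤ 1)
    {mN : ℕ} (hnbr : ∀ (x : MemberY θ.d₆ θ.ℓ₆ θ.hd' θ.hL' θ.b₀ θ.b₁ Mstar) (y : (geo9Y x).Site), (nbr (geo9Y x) 2 y).card ≤ mN)
    {ι : MemberY θ.d₆ θ.ℓ₆ θ.hd' θ.hL' θ.b₀ θ.b₁ Mstar → Type}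
    (𝔬 : ∀ x : MemberY θ.d₆ θ.ℓ₆ θ.hd' θ.hL' θ.b₀ θ.b₁ Mstar, Ops (geo9Y x) (bg9YR (Matrix (Fin N) (Fin N) ℂ) (specialUnitaryUnits (Fin N)) R₁ R₂ x)
      (XSK κ x.toKIdx) (XSK κ x.toKIdx) (ι x))
    (rd : ∀ x : MemberY θ.d₆ θ.ℓ₆ θ.hd' θ.hL' θ.b₀ θ.b₁ Mstar, WalkReading (geo9Y x) (bg9YR (Matrix (Fin N) (Fin N) ℂ) (specialUnitaryUnits (Fin N)) R₁ R₂ x)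
      (XSK κ x.toKIdx) (ι x))
    (H : MemberY θ.d₆ θ.ℓ₆ θ.hd' θ.hL' θ.b₀ θ.b₁ Mstar → Prop) {m mN' : ℕ} {Cev NQ : ℝ} {p q : PinPrims} (hp : p.OK) {p3 q3 : PairPrims}
    {pM qM : MixedPrims}
    {K : ∀ x : MemberY θ.d₆ θ.ℓ₆ θ.hd' θ.hL' θ.b₀ θ.b₁ Mstar, B9.KernelFamily (geo9Y x) (bg9YR (Matrix (Fin N) (Fin N) ℂ) (specialUnitaryUnits (Fin N)) R₁ R₂ x)}
    (t37 : B9.Thm37Printed c35 (fun x : MemberY θ.d₆ θ.ℓ₆ θ.hd' θ.hL' θ.b₀ θ.b₁ Mstar => geo9Y x)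
      (fun x => bg9YR (Matrix (Fin N) (Fin N) ℂ) (specialUnitaryUnits (Fin N)) R₁ R₂ x)
      (fun x => E37YPairM (bg := bg9YR (Matrix (Fin N) (Fin N) ℂ) (specialUnitaryUnits (Fin N)) R₁ R₂) m mN' Cev NQ p q p3 q3 pM qM (𝔬 x) (rd x) (H x) (K x)))
    (hblkS : ∀ x : MemberY θ.d₆ θ.ℓ₆ θ.hd' θ.hL' θ.b₀ θ.b₁ Mstar, (𝔬 x).blk = blkSK x.toKIdx (sIK x.toKIdx (bI x)))
    (hblkYS : ∀ x : MemberY θ.d₆ θ.ℓ₆ θ.hd' θ.hL' θ.b₀ θ.b₁ Mstar, (𝔬 x).blkY = blkSK x.toKIdx (sIK x.toKIdx (bI x)))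
    (hGpS : ∀ (x : MemberY θ.d₆ θ.ℓ₆ θ.hd' θ.hL' θ.b₀ θ.b₁ Mstar) (U : (bg9YR (Matrix (Fin N) (Fin N) ℂ) (specialUnitaryUnits (Fin N)) R₁ R₂ x).Cfg),
      (𝔬 x).Gp U = GcoS x.toKIdx b (bg9YR (Matrix (Fin N) (Fin N) ℂ) (specialUnitaryUnits (Fin N)) R₁ R₂ x) (fun U => U) (𝔏 x).Gp U)
    (hDS : ∀ (x : MemberY θ.d₆ θ.ℓ₆ θ.hd' θ.hL' θ.b₀ θ.b₁ Mstar) (U : (bg9YR (Matrix (Fin N) (Fin N) ℂ) (specialUnitaryUnits (Fin N)) R₁ R₂ x).Cfg),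
      (𝔬 x).D U = DcoS x.toKIdx b (bg9YR (Matrix (Fin N) (Fin N) ℂ) (specialUnitaryUnits (Fin N)) R₁ R₂ x) (fun U => U) U) :
    Thm31SiteSchemasR (Matrix (Fin N) (Fin N) ℂ) (specialUnitaryUnits (Fin N)) c35 𝔏 R₁ R₂ :=
  thm31SiteSchemasR_of_leftSymm R₁ R₂ specialUnitaryUnits_le_unitaryUnits hGR _
    (thm31LeftSchemaSymmR_of_std R₁ R₂ specialUnitaryUnits_le_unitaryUnits hGR 𝔏 hparS hGp
      (thm31LeftSchemaR_of_t37_pairM R₁ R₂ specialUnitaryUnits_le_unitaryUnits hGR b 𝔏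
        (fun x _ hUG z w => by rw [hparS x]; exact parSymY_mem x.toKIdx hUG z w) hlev hβ1 hnbr 𝔬 rd H hp t37 hblkS hblkYS hGpS hDS))

/-! ## §2 ★★★ Row 25 of the R-generic certificate in one call -/

/-- ★★★ **ROW 25 OF THE R-GENERIC N06 CERTIFICATE AT ANY LETTERS FAMILY WITH THE STANDARD `parS ∕ Gp`**: (3.49) for the genuine `P = I − R(U)` at the
class-parametric carrier — `B9.Stmt349Printed (d+1) c35 geo9Y (bg9YR … R₁ R₂) (x ↦ fineKernelR R₁ R₂ (p349SiteY … x (𝔏 x)))` (the `s349` slot of `b9LeafX_carriersYR`,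
`= fineKernelR R₁ R₂ (ops x).P349` by `rfl` at the `opsYS349Nu…` instances) — from ROW 18's leaf `t37` on the `PairM` E-letter at the four site pins over the
carrier, ROWS 15–16's one display `h348` premised on the carrier's (3.35), the faithful block map (`hlev`, `hβ1`), the radius-2 count (`hnbr`), and the displayed
`hGR : MemOfFam SU(N) R₁` — the R-twin of `B9Ineq349SiteFacesAtLetters.s349_site_of_t37_display348_of`.
[cite: Balaban1985BackgroundPropagators, (3.49) p.399 («using again Lemma 2.1»); Thm 3.1 ⇐ Thm 3.7 p.410; Thm 3.2 ⇐ Thm 3.9 p.413 + (3.96) p.411; (3.25) p.394, (3.35) p.396; Balaban1984PropagatorsII, Lemma 2.1 p.234, (2.51) p.232] -/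
theorem s349_site_of_t37_display348_of_R (θ : Stage3Params) (Mstar : ℕ)
    (R₁ R₂ : RegFamY θ.d₆ θ.ℓ₆ θ.hd' θ.hL' θ.b₀ θ.b₁ Mstar (Matrix (Fin N) (Fin N) ℂ)) (hGR : MemOfFam (specialUnitaryUnits (Fin N)) R₁)
    (𝔏 : LettersY N θ Mstar)
    (hparS : ∀ x : MemberY θ.d₆ θ.ℓ₆ θ.hd' θ.hL' θ.b₀ θ.b₁ Mstar, (𝔏 x).parS = parSymY x.toKIdx)
    (hGp : ∀ x : MemberY θ.d₆ θ.ℓ₆ θ.hd' θ.hL' θ.b₀ θ.b₁ Mstar, (𝔏 x).Gp = GpY x.toKIdx (parSymY x.toKIdx))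
    [∀ x : MemberY θ.d₆ θ.ℓ₆ θ.hd' θ.hL' θ.b₀ θ.b₁ Mstar, Fintype (geo9Y x).Site] [∀ x : MemberY θ.d₆ θ.ℓ₆ θ.hd' θ.hL' θ.b₀ θ.b₁ Mstar, DecidableEq (geo9Y x).Site]
    (b : Module.Basis κ ℝ (Matrix (Fin N) (Fin N) ℂ)) {c35 : ℝ}
    {bI : ∀ x : MemberY θ.d₆ θ.ℓ₆ θ.hd' θ.hL' θ.b₀ θ.b₁ Mstar, FBondY x.toKIdx → IBondY x.toKIdx}
    (hlev : ∀ (x : MemberY θ.d₆ θ.ℓ₆ θ.hd' θ.hL' θ.b₀ θ.b₁ Mstar) (f : FBondY x.toKIdx), lvl x.hN x.D x.hk (bI x f) = (blkV1 x.hN x.D f).1.1)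
    (hβ1 : ∀ (x : MemberY θ.d₆ θ.ℓ₆ θ.hd' θ.hL' θ.b₀ θ.b₁ Mstar) (f : FBondY x.toKIdx),
      (B6Geom246MultiLevelTorus.geomT x.D).dist (β x.hN x.D x.hk (bI x f)) (blkV1 x.hN x.D f) ≤ 1)
    {mN : ℕ} (hnbr : ∀ (x : MemberY θ.d₆ θ.ℓ₆ θ.hd' θ.hL' θ.b₀ θ.b₁ Mstar) (y : (geo9Y x).Site), (nbr (geo9Y x) 2 y).card ≤ mN)
    -- row 18: Theorem 3.7's leaf on the `PairM` E-letter at the site pins, over the carrier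
    {ι : MemberY θ.d₆ θ.ℓ₆ θ.hd' θ.hL' θ.b₀ θ.b₁ Mstar → Type}
    (𝔬 : ∀ x : MemberY θ.d₆ θ.ℓ₆ θ.hd' θ.hL' θ.b₀ θ.b₁ Mstar, Ops (geo9Y x) (bg9YR (Matrix (Fin N) (Fin N) ℂ) (specialUnitaryUnits (Fin N)) R₁ R₂ x)
      (XSK κ x.toKIdx) (XSK κ x.toKIdx) (ι x))
    (rd : ∀ x : MemberY θ.d₆ θ.ℓ₆ θ.hd' θ.hL' θ.b₀ θ.b₁ Mstar, WalkReading (geo9Y x) (bg9YR (Matrix (Fin N) (Fin N) ℂ) (specialUnitaryUnits (Fin N)) R₁ R₂ x)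
      (XSK κ x.toKIdx) (ι x))
    (H : MemberY θ.d₆ θ.ℓ₆ θ.hd' θ.hL' θ.b₀ θ.b₁ Mstar → Prop) {m mN' : ℕ} {Cev NQ : ℝ} {p q : PinPrims} (hp : p.OK) {p3 q3 : PairPrims}
    {pM qM : MixedPrims}
    {K : ∀ x : MemberY θ.d₆ θ.ℓ₆ θ.hd' θ.hL' θ.b₀ θ.b₁ Mstar, B9.KernelFamily (geo9Y x) (bg9YR (Matrix (Fin N) (Fin N) ℂ) (specialUnitaryUnits (Fin N)) R₁ R₂ x)}
    (t37 : B9.Thm37Printed c35 (fun x : MemberY θ.d₆ θ.ℓ₆ θ.hd' θ.hL' θ.b₀ θ.b₁ Mstar => geo9Y x)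
      (fun x => bg9YR (Matrix (Fin N) (Fin N) ℂ) (specialUnitaryUnits (Fin N)) R₁ R₂ x)
      (fun x => E37YPairM (bg := bg9YR (Matrix (Fin N) (Fin N) ℂ) (specialUnitaryUnits (Fin N)) R₁ R₂) m mN' Cev NQ p q p3 q3 pM qM (𝔬 x) (rd x) (H x) (K x)))
    (hblkS : ∀ x : MemberY θ.d₆ θ.ℓ₆ θ.hd' θ.hL' θ.b₀ θ.b₁ Mstar, (𝔬 x).blk = blkSK x.toKIdx (sIK x.toKIdx (bI x)))
    (hblkYS : ∀ x : MemberY θ.d₆ θ.ℓ₆ θ.hd' θ.hL' θ.b₀ θ.b₁ Mstar, (𝔬 x).blkY = blkSK x.toKIdx (sIK x.toKIdx (bI x)))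
    (hGpS : ∀ (x : MemberY θ.d₆ θ.ℓ₆ θ.hd' θ.hL' θ.b₀ θ.b₁ Mstar) (U : (bg9YR (Matrix (Fin N) (Fin N) ℂ) (specialUnitaryUnits (Fin N)) R₁ R₂ x).Cfg),
      (𝔬 x).Gp U = GcoS x.toKIdx b (bg9YR (Matrix (Fin N) (Fin N) ℂ) (specialUnitaryUnits (Fin N)) R₁ R₂ x) (fun U => U) (𝔏 x).Gp U)
    (hDS : ∀ (x : MemberY θ.d₆ θ.ℓ₆ θ.hd' θ.hL' θ.b₀ θ.b₁ Mstar) (U : (bg9YR (Matrix (Fin N) (Fin N) ℂ) (specialUnitaryUnits (Fin N)) R₁ R₂ x).Cfg),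
      (𝔬 x).D U = DcoS x.toKIdx b (bg9YR (Matrix (Fin N) (Fin N) ℂ) (specialUnitaryUnits (Fin N)) R₁ R₂ x) (fun U => U) U)
    -- rows 15–16: the one display `(3.48)⁻¹` on the faithful one-cube letters over `𝔏`, premised on the carrier's (3.35)
    (hc : 0 < c35) {B₁ δ₁ a₁ M₁ : ℝ} (hB : 0 ≤ B₁) (hδ : 0 < δ₁) (ha₁ : 0 < a₁) (hM₁ : 0 < M₁)
    (h348 : ∀ x : MemberY θ.d₆ θ.ℓ₆ θ.hd' θ.hL' θ.b₀ θ.b₁ Mstar, M₁ ≤ (geo9Y x).M → ∀ α₀ : ℝ, 0 < α₀ → c35 * (geo9Y x).M * α₀ ≤ a₁ →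
      ∀ U : (bg9YR (Matrix (Fin N) (Fin N) ℂ) (specialUnitaryUnits (Fin N)) R₁ R₂ x).Cfg,
        (bg9YR (Matrix (Fin N) (Fin N) ℂ) (specialUnitaryUnits (Fin N)) R₁ R₂ x).Reg335 c35 α₀ U → Conv348Blk (oneCubeOps39YF θ Mstar 𝔏 bI x) B₁ δ₁ U) :
    B9.Stmt349Printed (θ.d₆ + 1) c35 (geo9Y (d := θ.d₆) (ℓ := θ.ℓ₆) (hd := θ.hd') (hL := θ.hL') (b₀ := θ.b₀) (b₁ := θ.b₁) (Mstar := Mstar))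
      (bg9YR (Matrix (Fin N) (Fin N) ℂ) (specialUnitaryUnits (Fin N)) R₁ R₂)
      (fun x => fineKernelR R₁ R₂ (p349SiteY (Matrix (Fin N) (Fin N) ℂ) (specialUnitaryUnits (Fin N)) x (𝔏 x))) :=
  stmt349Printed_site_of_blockSchemas_R 𝔏 R₁ R₂
    (thm31SiteSchemasR_of_t37_pairM_of θ Mstar R₁ R₂ hGR 𝔏 hparS hGp b hlev hβ1 hnbr 𝔬 rd H hp t37 hblkS hblkYS hGpS hDS)
    (thm32BlkSchemaR_of_display348 θ Mstar 𝔏 R₁ R₂ bI hlev hβ1 hc hB hδ ha₁ hM₁ h348)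

end Literature.MathematicalPhysics.QuantumFieldTheory.Balaban1983to89.B9Ineq349SiteFacesAtLettersR

end
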